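import Summits.ValiantsHypothesis.ValiantsHypothesis.Theorems.LacunarySymmetroidMatrixDescartesPivotRankOneReduction

/-!
# `MatrixDescartes` census — the `m = 2` pivot row: THE `2K` LAW HOLDS OFF THE INTERLEAVING LOCUS
# (any `K`, any PSD letters, any pivot: a `(2,K)` pencil with more than `2K` positive roots must have its `K + 1` pivot-type
# degrees pairwise distinct and perfectly interleaved with letter-pair degrees)

HONEST FRAMING.  Object-search cell `pub-symmetroid`, seat `val-sym-mdr-p1` (generation 13); helper file `--supports` the crux item
stmt-ValiantsHypothesis-18050 (`Theses.LacunarySymmetroid.MatrixDescartes`, OPEN, on HOLD) with NO closure claim.  A structure theorem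
for the open pivot row «`(2,K) ≤ 2K`» (conjb-1 currency `…CensusPivotDefs`; kernel: `≤ 2K + 2` always, `= 2K` attained for
`K ≤ 6`, `(2,4)₁ ∈ {8,9,10}`): it does NOT prove the row, it says WHERE a violation must live.  Generalises the seat's
`…PivotRankOneReduction` (rank-one `(2,4)₁`: `≤ 8` outside two chambers) to every `K` and every rank.

SETTING (tree, `…CensusPivotTwoDescartes`).  `F = X^e J + ∑ₖ X^{dₖ} Pₖ`, `Pₖ ⪰ 0` real `2 × 2`, `J` ANY real `2 × 2` matrix.  The
coefficient of `det F` at degree `n` is a sum over splittings `n = a + b` of mixed discriminants of the aggregated letters at `a` and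
`b`; it is `≥ 0` unless `n` is PIVOT-TYPE (`n = 2e` or `n = e + dₖ`: `TwoDescartes.coeff_det_nonneg_of_not_mem`), whence
`Z₊ ≤ 2·#{pivot-type degrees} ≤ 2K + 2` (`TwoDescartes.pivotTwo_posRoots_le`), and it VANISHES unless `n` is a sum of two exponents of
the pencil (`coeff_det_eq_zero_of_not_sum`, this file).

**THEOREM (`posRoots_le_two_mul_of_gap`, pivot currency `pivotPosRoots_le_two_mul_of_gap`).**  If two pivot-type degrees `N < N'`
have no pivot-type degree and no letter-pair degree `dᵢ + dⱼ` (`i = j` allowed) strictly between them, then `Z₊ ≤ 2K`.  PROOF: if the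
coefficient at `N` or at `N'` is `≥ 0`, at most `K` coefficients are negative (`TwoDescartes.card_posRoots_le_two_mul_card`); otherwise
`[N, N']` is a window of non-positive coefficients with at most `K − 1` negative degrees outside it, and the window lemma
`RankOneReduction.signVariations_le_of_nonpos_window` gives `Var ≤ 2(K − 1) + 2`.  Companion: `posRoots_le_two_mul_of_eq_exponent` (two
letters at one exponent ⇒ `≤ K` pivot-type degrees ⇒ `2K`; cf. the tree's `…PivotTwoCore.posRoots_le_two_mul_of_eq_pivot` for a letter
AT the pivot exponent).
READING.  A `(2,K)` pencil beating `2K` needs: all `dₖ` distinct and `≠ e`, and between EVERY two consecutive members of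
`{2e} ∪ {e + dₖ}` some `dᵢ + dⱼ` — the «interleaving locus» (for `K = 4` with two letters on each side and rank-one letters: exactly the
two chambers of `…PivotRankOneReduction`; the kernel EIGHTS `…PivotTwoFourWitness` (resonant), `…PivotTwoFourInterleaved`,
`…PivotRankOneEight` all reach only `2K`).  Nothing here bears on `MatrixDescartes` in its window, on `DoorA26` / `DoorA34`, registers /
credences, or `VP ≠ VNP`.

[folklore] Descartes bookkeeping; tree lemmas named above.  No definitions, no named facts.
-/

-- `Summit.ValiantsHypothesis.ValiantsHypothesis.…` repeats a component by the D-0017 layout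
-- (single-conjunct summit), which the `dupNamespace` linter flags; the name is mandated.
set_option linter.dupNamespace false

namespace Summit.ValiantsHypothesis.ValiantsHypothesis.Theorems.LacunarySymmetroidMatrixDescartes.Pivot.TwoGap

open Polynomial Matrix Finset
open scoped BigOperators

variable {K : ℕ}

/-- A coefficient of `det F` at a degree that is NOT a sum of two exponents of the pencil (pivot or letters) vanishes. [folklore] -/
theorem coeff_det_eq_zero_of_not_sum (e : ℕ) (d : Fin K → ℕ) (J : Matrix (Fin 2) (Fin 2) ℝ)
    (P : Fin K → Matrix (Fin 2) (Fin 2) ℝ) (n : ℕ)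
    (hn : ∀ l l' : Option (Fin K), TwoDescartes.expo e d l + TwoDescartes.expo e d l' ≠ n) :
    (Matrix.det (∑ l, ((X : ℝ[X]) ^ TwoDescartes.expo e d l) • (TwoDescartes.letter J P l).map Polynomial.C)).coeff n = 0 := by
  rw [TwoDescartes.coeff_det]
  refine Finset.sum_eq_zero fun x hx => ?_
  obtain ⟨a, b⟩ := x
  replace hx : a + b = n := by simpa using hx
  by_cases ha : ∃ l, TwoDescartes.expo e d l = a
  · obtain ⟨l, hl⟩ := ha
    have hb : ∀ l', TwoDescartes.expo e d l' ≠ b := by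
      intro l' hl'
      exact hn l l' (by rw [hl, hl', hx])
    rw [TwoDescartes.agg_eq_zero e d J P b hb]
    simp
  · push Not at ha
    rw [TwoDescartes.agg_eq_zero e d J P a ha]
    simp

/-- **THE `2K` LAW OFF THE INTERLEAVING LOCUS** (`2 × 2` pivot pencils, `K` PSD letters, `J` arbitrary).  Let
`F = X^e J + ∑ₖ X^{dₖ} Pₖ` with every `Pₖ ⪰ 0`.  The negative coefficients of `det F` sit at the `K + 1` PIVOT-TYPE degrees `2e`,
`e + dₖ` (tree, `TwoDescartes.coeff_det_nonneg_of_not_mem`; hence `Z₊ ≤ 2K + 2`).  If two pivot-type degrees `N < N'` have NO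
pivot-type degree and NO letter-pair degree `dᵢ + dⱼ` (`i, j` arbitrary, `i = j` allowed) STRICTLY between them, then
`Z₊ ≤ 2K`: either one of the two (merged) coefficients at `N`, `N'` is `≥ 0` — then at most `K` coefficients are negative — or both
are negative and `[N, N']` is a window of non-positive coefficients with at most `K − 1` negative degrees outside it (window lemma
`RankOneReduction.signVariations_le_of_nonpos_window`: `Var ≤ 2(K−1) + 2`).  So every pencil violating the conjectured row
«`(2,K) ≤ 2K`» has its `K + 1` pivot-type degrees pairwise distinct and PERFECTLY INTERLEAVED with letter-pair degrees. [this file] -/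
theorem posRoots_le_two_mul_of_gap (e : ℕ) (d : Fin K → ℕ) (J : Matrix (Fin 2) (Fin 2) ℝ)
    (P : Fin K → Matrix (Fin 2) (Fin 2) ℝ) (hP : ∀ k, (P k).PosSemidef) (N N' : ℕ) (hNN' : N < N')
    (hN : N = 2 * e ∨ ∃ k, N = e + d k) (hN' : N' = 2 * e ∨ ∃ k, N' = e + d k)
    (hgap_e : ¬ (N < 2 * e ∧ 2 * e < N')) (hgap_s : ∀ k, ¬ (N < e + d k ∧ e + d k < N'))
    (hgap_p : ∀ i j, ¬ (N < d i + d j ∧ d i + d j < N')) :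
    ((Matrix.det (((X : ℝ[X]) ^ e) • J.map Polynomial.C
        + ∑ k, ((X : ℝ[X]) ^ d k) • (P k).map Polynomial.C)).roots.toFinset.filter (fun t => 0 < t)).card
      ≤ 2 * K := by
  classical
  rw [TwoDescartes.pencil_eq_sum]
  set g := Matrix.det (∑ l, ((X : ℝ[X]) ^ TwoDescartes.expo e d l) • (TwoDescartes.letter J P l).map Polynomial.C)
    with hg
  let T : Finset ℕ := Finset.univ.image (fun l : Option (Fin K) => e + TwoDescartes.expo e d l)
  have hT : T.card ≤ K + 1 := by
    refine le_trans Finset.card_image_le ?_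
    simp [Fintype.card_option]
  have hneg : ∀ n, g.coeff n < 0 → n ∈ T := by
    intro n hn
    by_contra hnot
    have hn' : ∀ l, e + TwoDescartes.expo e d l ≠ n := by
      intro l hl
      exact hnot (Finset.mem_image.mpr ⟨l, Finset.mem_univ _, hl⟩)
    exact absurd hn (not_lt.mpr (TwoDescartes.coeff_det_nonneg_of_not_mem e d J P hP n hn'))
  have hNT : N ∈ T := by
    rcases hN with h | ⟨k, h⟩
    · exact Finset.mem_image.mpr ⟨none, Finset.mem_univ _, by simp [TwoDescartes.expo]; omega⟩
    · exact Finset.mem_image.mpr ⟨some k, Finset.mem_univ _, by simp [TwoDescartes.expo]; omega⟩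
  have hN'T : N' ∈ T := by
    rcases hN' with h | ⟨k, h⟩
    · exact Finset.mem_image.mpr ⟨none, Finset.mem_univ _, by simp [TwoDescartes.expo]; omega⟩
    · exact Finset.mem_image.mpr ⟨some k, Finset.mem_univ _, by simp [TwoDescartes.expo]; omega⟩
  -- Step 1: a non-negative coefficient at `N` or `N'`
  have step1 : ∀ s, s ∈ T → 0 ≤ g.coeff s → (g.roots.toFinset.filter (fun t => 0 < t)).card ≤ 2 * K := by
    intro s hs h0
    have h := TwoDescartes.card_posRoots_le_two_mul_card g (T.erase s) (fun n hn => by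
      refine Finset.mem_erase.mpr ⟨fun h => ?_, hneg n hn⟩
      rw [h] at hn; exact absurd hn (not_lt.mpr h0))
    rw [Finset.card_erase_of_mem hs] at h
    omega
  by_cases h1 : 0 ≤ g.coeff N
  · exact step1 N hNT h1
  by_cases h2 : 0 ≤ g.coeff N'
  · exact step1 N' hN'T h2
  push Not at h1 h2
  -- Step 2: the window `[N, N']`
  have hwin : ∀ m, N ≤ m → m ≤ N' → g.coeff m ≤ 0 := by
    intro m ha hb
    rcases Nat.eq_or_lt_of_le ha with h | h
    · rw [← h]; exact h1.le
    rcases Nat.eq_or_lt_of_le hb with h' | h'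
    · rw [h']; exact h2.le
    refine le_of_eq (coeff_det_eq_zero_of_not_sum e d J P m fun l l' hll' => ?_)
    rcases l with _ | i <;> rcases l' with _ | j <;> simp only [TwoDescartes.expo] at hll'
    · exact hgap_e ⟨by omega, by omega⟩
    · exact hgap_s j ⟨by omega, by omega⟩
    · exact hgap_s i ⟨by omega, by omega⟩
    · exact hgap_p i j ⟨by omega, by omega⟩
  have hw := RankOneReduction.signVariations_le_of_nonpos_window g N N' hNN'.le hwin ((T.erase N).erase N')
    (fun m hm hout => by
      refine Finset.mem_erase.mpr ⟨by omega, Finset.mem_erase.mpr ⟨by omega, hneg m hm⟩⟩)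
  have hc1 : ((T.erase N).erase N').card + 2 = T.card := by
    have hN'm : N' ∈ T.erase N := Finset.mem_erase.mpr ⟨by omega, hN'T⟩
    rw [Finset.card_erase_of_mem hN'm, Finset.card_erase_of_mem hNT]
    have : 2 ≤ T.card := by
      have hsub : ({N, N'} : Finset ℕ) ⊆ T := by
        intro x hx
        simp only [Finset.mem_insert, Finset.mem_singleton] at hx
        rcases hx with rfl | rfl
        · exact hNT
        · exact hN'T
      have := Finset.card_le_card hsub
      rw [Finset.card_pair (by omega)] at this
      exact this
    omega
  exact (Census.card_posRoots_le_signVariations g).trans (by omega)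

/-- **Pivot currency**: `pivotPosRoots e d J P ≤ 2K` off the interleaving locus (same hypotheses). [this file] -/
theorem pivotPosRoots_le_two_mul_of_gap (e : ℕ) (d : Fin K → ℕ) (J : Matrix (Fin 2) (Fin 2) ℝ)
    (P : Fin K → Matrix (Fin 2) (Fin 2) ℝ) (hP : ∀ k, (P k).PosSemidef) (N N' : ℕ) (hNN' : N < N')
    (hN : N = 2 * e ∨ ∃ k, N = e + d k) (hN' : N' = 2 * e ∨ ∃ k, N' = e + d k)
    (hgap_e : ¬ (N < 2 * e ∧ 2 * e < N')) (hgap_s : ∀ k, ¬ (N < e + d k ∧ e + d k < N'))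
    (hgap_p : ∀ i j, ¬ (N < d i + d j ∧ d i + d j < N')) :
    pivotPosRoots e d J P ≤ 2 * K := by
  unfold pivotPosRoots
  exact posRoots_le_two_mul_of_gap e d J P hP N N' hNN' hN hN' hgap_e hgap_s hgap_p

/-- **Two letters at one exponent ⇒ `Z₊ ≤ 2K`**: then at most `K` pivot-type degrees carry negative coefficients.
[this file; cf. the tree's `…PivotTwoCore.posRoots_le_two_mul_of_eq_pivot` for a letter at the pivot exponent] -/
theorem posRoots_le_two_mul_of_eq_exponent (e : ℕ) (d : Fin K → ℕ) (J : Matrix (Fin 2) (Fin 2) ℝ)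
    (P : Fin K → Matrix (Fin 2) (Fin 2) ℝ) (hP : ∀ k, (P k).PosSemidef) (i j : Fin K) (hij : i ≠ j) (hd : d i = d j) :
    ((Matrix.det (((X : ℝ[X]) ^ e) • J.map Polynomial.C
        + ∑ k, ((X : ℝ[X]) ^ d k) • (P k).map Polynomial.C)).roots.toFinset.filter (fun t => 0 < t)).card
      ≤ 2 * K := by
  classical
  rw [TwoDescartes.pencil_eq_sum]
  set g := Matrix.det (∑ l, ((X : ℝ[X]) ^ TwoDescartes.expo e d l) • (TwoDescartes.letter J P l).map Polynomial.C)
    with hg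
  let T : Finset ℕ := (Finset.univ.erase (some j)).image (fun l : Option (Fin K) => e + TwoDescartes.expo e d l)
  have hT : T.card ≤ K := by
    refine le_trans Finset.card_image_le ?_
    rw [Finset.card_erase_of_mem (Finset.mem_univ _)]
    simp [Fintype.card_option]
  have hneg : ∀ n, g.coeff n < 0 → n ∈ T := by
    intro n hn
    by_contra hnot
    have hn' : ∀ l, e + TwoDescartes.expo e d l ≠ n := by
      intro l hl
      rcases l with _ | k
      · exact hnot (Finset.mem_image.mpr ⟨none, by simp, hl⟩)
      · by_cases hk : k = j
        · subst hk
          exact hnot (Finset.mem_image.mpr ⟨some i, by simp [hij], by simp [TwoDescartes.expo] at hl ⊢; omega⟩)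
        · exact hnot (Finset.mem_image.mpr ⟨some k, by simp [hk], hl⟩)
    exact absurd hn (not_lt.mpr (TwoDescartes.coeff_det_nonneg_of_not_mem e d J P hP n hn'))
  have := TwoDescartes.card_posRoots_le_two_mul_card g T hneg
  omega

end Summit.ValiantsHypothesis.ValiantsHypothesis.Theorems.LacunarySymmetroidMatrixDescartes.Pivot.TwoGap
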